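import Literature.MathematicalPhysics.QuantumFieldTheory.Balaban1983to89.B5Hk163Torus
import Literature.MathematicalPhysics.QuantumFieldTheory.Balaban1983to89.B5DeltaA169

/-!
# Bałaban 1984 (Propagators I, CMP 95), §D p.29: «R∂*H_kB = 0» and the minimum property for the typed `H_k`

T. Bałaban, *Propagators and renormalization transformations for lattice gauge theories. I*,
Commun. Math. Phys. **95** (1984) 17–40, Section D (pp. 26–29), formulas (1.60)–(1.63) and the
projection `R` of (1.38) p.24 / (1.69) p.29.

## The audited sentence (p.29, verbatim, read from the page image)

«Using (1.60), or better (1.63), we can verify all the properties of H_kB: Q_kH_kB = B,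
R∂*H_kB = 0, H_kB is a minimum of ½⟨∂A, ∂A⟩ on the hyperplane {A : Q_kA = B, R∂*A = 0}, which
means that ⟨∂A′, ∂H_kB⟩ = 0 on the subspace {A′ : Q_kA′ = 0, R∂*A′ = 0}.»

with (p.24, verbatim) «Let us denote the projection operator by R, so we have
R = I − Δ⁻¹Q′_k*Q′_kΔ⁻²Q′_k*)⁻¹Q′_kΔ⁻¹. (1.38)» [sic: the opening parenthesis before `Q′_kΔ⁻²Q′_k*`
is missing in print; (1.35) p.24 fixes the reading `(Q′_kΔ⁻²Q′_k*)⁻¹`], (p.25, verbatim) «The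
projection operator R has a clear meaning. It is an orthogonal projection on the linear subspace
ΔN(Q′_k) of L²(T_η), N(Q′_k) = {λ : Q′_kλ = 0}.», (p.29, (1.69), verbatim) «Δ = ∂*∂ + ∂∂*, R = I − P,»,
(p.24, verbatim) «We have used also the equality (∂*A)~(p) = Σ_μ \overline{∂_μ(p)} Ã_μ(p)», and
(p.30, verbatim) «At first let us prove that Δ_a is a positive operator. Of course it is a symmetric
operator and it is non-negative as a sum of two non-negative operators Δ − ∂P∂* and aQ*Q, a > 0.
Thus if for some A we have Δ_aA = 0, then ΔA − ∂P∂*A = 0, QA = 0. (1.72)» … «so A = 0 and the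
positivity of Δ_a follows.»

The FIRST property «Q_kH_kB = B» is `B5Hk163Torus.QvOp_mul_HkOp` (kernel-certified earlier in this
lineage).  THIS MODULE certifies the SECOND property «R∂*H_kB = 0» and the THIRD property (the
minimum of `½⟨∂A, ∂A⟩`, «which means that ⟨∂A′, ∂H_kB⟩ = 0 …») for the same typed operator
`B5Hk163Torus.HkOp n M : Matrix (Tor (fine n M) × Fin d) (Tor M × Fin d) ℂ`, with the tree's typed
`P` = `B5Value126.PcT n M (n : ℂ)` (the torus reading of `Δ⁻¹Q′*_k(Q′_kΔ⁻²Q′*_k)⁻¹Q′_kΔ⁻¹`, (1.38) =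
(1.70), whose momentum representation is `B5Momentum133.dft_PcT_apply_of_ne` /
`dft_PcT_zero_fiber`), `R = I − P` ((1.69)), `∂* = (GradOp (fine n M) n)ᴴ` the adjoint of the gradient
of (1.21) (`B5Action121`; its symbol «(∂*A)~(p) = Σ_μ \overline{∂_μ(p)} Ã_μ(p)» is
`B5DeltaA169.dft_GradOp_adjoint`), and `⟨∂A, ∂A⟩` the form of `∂*∂ = Δ − ∂∂*` ((1.69), (1.21):
`B5Action121.form_curl_eq` «⟨∂A, ∂A⟩ = ½ Σ η^d|F_{μν}(x)|²»):

* `PcT_divS_HkOp` — `P ∂*H_kB = ∂*H_kB` for every coarse field `B`;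
* `R_divS_HkOp` — **«R∂*H_kB = 0»**: `(1 − P) ∂*H_kB = 0`; matrix form `R_mul_divS_mul_HkOp`;
* `form_DstarD_HkOp_eq_zero`, `curl_HkOp_orthogonal` — **«⟨∂A′, ∂H_kB⟩ = 0»** for every `A′` with
  `Q_kA′ = 0` (so in particular on the printed subspace `{A′ : Q_kA′ = 0, R∂*A′ = 0}`);
* `form_DstarD_decomp`, `HkOp_minimum`, `HkOp_minimum_curvature` — **«H_kB is a minimum of ½⟨∂A, ∂A⟩
  on the hyperplane {A : Q_kA = B, R∂*A = 0}»**: `H_kB` lies on it and `⟨A, ∂*∂A⟩ = ⟨A′, ∂*∂A′⟩ +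
  ⟨H_kB, ∂*∂H_kB⟩ ≥ ⟨H_kB, ∂*∂H_kB⟩` for EVERY fine `A` with `Q_kA = B` (`A′ = A − H_kB`), i.e.
  `Σ|F_{μν}[H_kB]|² ≤ Σ|F_{μν}[A]|²`;
* `HkOp_minimum_unique`, `eq_HkOp_iff_minimum` (§5, v1.1) — the minimum ON THE PRINTED HYPERPLANE is
  UNIQUE: `A = H_kB ⟺ (Q_kA = B ∧ R∂*A = 0 ∧ A minimises ⟨·, ∂*∂·⟩ on that hyperplane)`, by the
  positivity of `Δ_a` (p.30, (1.72); the tree's `B5DeltaA169.DeltaA_posDef`): on the printed subspace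
  `{Q_kA′ = 0, R∂*A′ = 0}` one has `Δ_aA′ = ∂*∂A′` (`DeltaA_mulVec_eq_DstarD_mulVec`).

## Version

v1 = p188325 (§1–§4).  v1.1 = p188404 APPENDS §5 (uniqueness of the minimiser on the printed
hyperplane; three theorems) and amends this header accordingly; every declaration of v1 is unchanged.
v1.2 (this file) is DOCSTRING-ONLY (code byte-identical to v1.1): the two mentions of (1.61) now quote the
print verbatim, «v_μ(p) = ∂¹_μ(p′)/∂_μ(p),» (p. 28), instead of its cleared-denominator rearrangement inside
guillemets (cross-read C-pv14-98, DOCFIX D1); the sequel `B5Hk163Form166` (p188712) proves (1.65) = (1.66)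
for this `H_k` and `HkOp = Beta.FluctuationProjection.Hk` ((1.63) = (1.103)).

## Route (exactly the paper's: «Using … (1.63), we can verify …»)

§1 is symbol-agnostic algebra over the closed form (1.63) as typed in `B5Symbol163` (`second163`
= head + tail of (1.63), with the closed inner sum `sum_second_eq`): contracting the fibre vector
`l ↦ (H̃_kB)_μ(l)` against `\overline{∂_μ(p′+l)}` and summing over `μ` with (1.61)
«v_μ(p) = ∂¹_μ(p′)/∂_μ(p),» (used in the cleared form `∂¹_μ(p′) = v_μ(p)∂_μ(p)`) and `Δ(p) = Σ_μ|∂_μ(p)|²`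
(the symbol of the Laplacian, `B5Prop11Fiber.Delta_eq`) gives

  `(∂*H_kB)~(p′+l) = \overline{u(p′+l)}/Δ(p′+l) · g(p′)`,
  `g = Δ₀ · N⁻¹ · S⁻¹ · Σ_λ \overline{∂¹_λ} B̃_λ/(Δ₀φ_λ)`  (`div_second163`, `gSym`),

`S = Σ_l |u|²Δ₀²/Δ²` = the symbol of `Δ₀²·Q′_kΔ⁻²Q′*_k`, `N = Σ_ν |∂¹_ν|²/(Δ₀²φ_ν)` — i.e.
`∂*H_kB = Δ⁻¹Q′*_k (Q′_kΔ⁻²Q′*_k)⁻¹λ′` with `λ′ = (∂₁*φ⁻¹∂₁)⁻¹∂₁*φ⁻¹B′` of p.27, which is visibly in the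
range `Δ⁻¹Q′*_k(·)` of `P`; the fibre symbol of `P` ((1.35)/(1.38): `ū(l)/Δ(l)·X⁻¹·Σ_{l′}u(l′)/Δ(l′)·ω(l′)`,
`X = Σ|u|²/Δ²`) fixes every vector of the shape `ū(l)/Δ(l)·c` (`pSym_range`).  §1 also records the
companion identity behind the THIRD property («minimum», equivalently the Euler–Lagrange equation
(1.50) with `P∂*A = ∂*A`): `Δ(p′+l)(H̃_kB)_μ(l) − ∂_μ(p′+l)(∂*H_kB)~(p′+l) = \overline{u v_μ}(p′+l)·w_μ(p′)`
(`lap_sub_grad_div_second163`, `wSym` = the symbol of `φ⁻¹B′ − φ⁻¹∂₁λ′ = −ω` of p.27), i.e.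
`(Δ − ∂∂*)H_kB ∈ Ran Q_k*` fibrewise.
§2 instantiates §1 on the torus leaves `p′ = sOf q ≠ 0` of B5's data (`uSym`, `vSym`, `dSym`, `d1Sym`,
`DeltaXir`, `Delta1r`, `phi162`; the kernel entries `h163` of `B5Hk163Strip` via
`second163_eq_sum_h163`) and treats the zero fibre `p′ = 0` separately (there `(∂*H_kB)~ = 0`).
§3 lifts to the typed operators through the DFT (`dft_HkOp`, `dft_GradOp_adjoint`,
`dft_PcT_apply_of_ne`, `dft_PcT_zero_fiber`) and the injectivity of the unitary DFT.
§4 lifts the companion identity: with «Δ(p) = Σ_μ|∂_μ(p)|²» (`B5FiberDelta.dft_Lap`) and the symbol of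
the gradient (`B5DeltaA169.dft_comp_GradOp`), `(∂*∂ H_kB)^_κ(p′+l) = c_Q⁻¹·\overline{u v_κ}(p′+l)·w_κ(p′)`
(zero on the fibre `p′ = 0`); Parseval and the momentum form (1.61) of `Q_k` (`B5Block118.dft_QvOp`)
give `⟨A′, ∂*∂H_kB⟩ = Σ_{p′≠0,κ} c_Q⁻¹ w_κ \overline{Σ_l u v_κ Â′_κ(p′+l)} = 0` for `Q_kA′ = 0`, and the
minimum property follows from `∂*∂ ≥ 0` (`B5Action121.form_curl_nonneg`) by the decomposition
`A = (A − H_kB) + H_kB`, `Q_k(A − H_kB) = 0` (`B5Hk163Torus.QvOp_HkOp_mulVec`).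
§5: if moreover `R∂*A = 0` and `⟨A, ∂*∂A⟩ ≤ ⟨H_kB, ∂*∂H_kB⟩`, then `A′ = A − H_kB` satisfies
`Q_kA′ = 0`, `P∂*A′ = ∂*A′`, `⟨A′, ∂*∂A′⟩ = 0`, so `⟨A′, Δ_aA′⟩ = ⟨A′, (Δ − ∂P∂* + aQ*Q)A′⟩ = ⟨A′, ∂*∂A′⟩
= 0` and `A′ = 0` by «Δ_a is a positive operator».

## HONEST SCOPE

Certified here, on every torus `T_η`, `η = 1/n`, `n ≥ 1`, every `M` (all `NeZero`), every dimension
`d`, for the tree's typed `HkOp` (the torus operator whose momentum kernel is (1.63)), the tree's typed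
`P` (`B5Value126.PcT`, with the pseudo-inverse reading of `Δ⁻¹` on the torus documented in
`B5Value126`/`B5LaplaceInverse`) and the tree's typed `Q_k`, `∂`, `Δ`: (i) the operator identity
`(1 − P)·∂*·H_k = 0`; (ii) `⟨A′, ∂*∂ H_kB⟩ = 0` and `⟨CurlOp A′, CurlOp H_kB⟩ = 0` for all `A′ ∈ N(Q_k)`;
(iii) `⟨H_kB, ∂*∂H_kB⟩ ≤ ⟨A, ∂*∂A⟩` (equivalently `Σ|F[H_kB]|² ≤ Σ|F[A]|²`) for all `A` with `Q_kA = B`.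
(iv) (§5) uniqueness: an `A` on the printed hyperplane `{Q_kA = B, R∂*A = 0}` with
`⟨A, ∂*∂A⟩ ≤ ⟨H_kB, ∂*∂H_kB⟩` equals `H_kB`.
Remarks of honesty: (a) the minimum in (iii) is over the whole affine space `{Q_kA = B}` — the form
`⟨∂A, ∂A⟩` is degenerate along `A ↦ A + ∂λ`, and the printed gauge condition `R∂*A = 0` (which `H_kB`
satisfies by (i)) is what singles out `H_kB` (iv); the uniqueness proof imports the positivity of
`Δ_a` from the tree (`B5DeltaA169.DeltaA_posDef`, whose proof is the package's, via the Fourier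
blocks (1.83), not the paper's three-line argument (1.72)).  (b) `Δ⁻¹` in `P` is the torus pseudo-inverse of the tree
(zero mode projected out), as in every earlier module of this lineage.  (c) Nothing here is summit
progress: it is a kernel re-verification of one sentence of a published paper for the typed objects of
this package; (1.64)–(1.67) are not touched.

## ABSOLUTE-RULE census

No hypothesis of any theorem below is an internally minted statement: all statements are closed
identities over the package's definitions, proved in the kernel; the quoted sentences above are
verbatim from the page images of the published paper (pp. 24, 25, 29, 30) and serve as documentation
only.
-/

open scoped BigOperators Matrix ComplexConjugate
open Finset Complex

namespace Literature.MathematicalPhysics.QuantumFieldTheory.Balaban1983to89.B5Hk163RDiv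

open Literature.MathematicalPhysics.QuantumFieldTheory.Balaban1983to89.B4Strip (ofRealVec shiftr DeltaXi
  DeltaXir Delta1r S1r)
open Literature.MathematicalPhysics.QuantumFieldTheory.Balaban1983to89.B5Symbol166 (S1r_pos_of_ne)
open Literature.MathematicalPhysics.QuantumFieldTheory.Balaban1983to89.B5Action165Lagrange (phi162_pos)
open Literature.MathematicalPhysics.QuantumFieldTheory.Balaban1983to89.B5Prop11Plancherel (Tor dft dftV fine sOf
  abs_sOf_le sOf_ne_zero sOf_zero star_dftV_mul)
open Literature.MathematicalPhysics.QuantumFieldTheory.Balaban1983to89.B5Prop11Lower (Lap)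
open Literature.MathematicalPhysics.QuantumFieldTheory.Balaban1983to89.B5Prop11Fiber (dSym d1Sym vSym uSym
  Delta_eq d1Sym_eq_vSym_mul norm_d1Sym_sq)
open Literature.MathematicalPhysics.QuantumFieldTheory.Balaban1983to89.B5Prop11Leaves (Delta1r_pos
  Delta1r_le_DeltaXir_shift)
open Literature.MathematicalPhysics.QuantumFieldTheory.Balaban1983to89.B5Action121 (comp GradOp divS Fs LapV CurlOp
  Lap_eq_LapV GradOp_conjTranspose_mulVec_eq form_curl_eq form_curl_nonneg curl_adjoint_curl
  star_mulVec_dotProduct)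
open Literature.MathematicalPhysics.QuantumFieldTheory.Balaban1983to89.B5Block118 (pOf pOf_bijective cQ QvOp
  dft_QvOp)
open Literature.MathematicalPhysics.QuantumFieldTheory.Balaban1983to89.B5Constraint130 (cQ_ne_zero)
open Literature.MathematicalPhysics.QuantumFieldTheory.Balaban1983to89.B5Symbol163 (head163 summand163
  second163 phiSym sSym nSym sum_second_eq sum_erase_eq_sum sSym_ne_zero)
open Literature.MathematicalPhysics.QuantumFieldTheory.Balaban1983to89.B5Hk163Strip (h163 headC tailC gdir rho
  second163_eq_sum_h163 phiSym_ofReal)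
open Literature.MathematicalPhysics.QuantumFieldTheory.Balaban1983to89.B5Hk163Qk (uSym_vSym_zero_ne_zero)
open Literature.MathematicalPhysics.QuantumFieldTheory.Balaban1983to89.B5Hk163Torus (HkOp dft_HkOp
  dft_mulVec_injective ofRealVec_zero DeltaXi_zero163 QvOp_HkOp_mulVec)
open Literature.MathematicalPhysics.QuantumFieldTheory.Balaban1983to89.B5Bounds167Lattice (phi162)
open Literature.MathematicalPhysics.QuantumFieldTheory.Balaban1983to89.B5Symbol166Strip (expFacNeg)
open Literature.MathematicalPhysics.QuantumFieldTheory.Balaban1983to89.B5LaplaceInverse (ssym lsym)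
open Literature.MathematicalPhysics.QuantumFieldTheory.Balaban1983to89.B5Momentum133 (ssym_pOf lsym_pOf
  lsym_pOf_ne_zero Xs Bs Xs_ne_zero dft_PcT_apply_of_ne dft_PcT_zero_fiber)
open Literature.MathematicalPhysics.QuantumFieldTheory.Balaban1983to89.B5Value126 (PcT)
open Literature.MathematicalPhysics.QuantumFieldTheory.Balaban1983to89.B5DeltaA169 (dft_GradOp_adjoint
  dft_comp_GradOp DeltaA DeltaA_mulVec DeltaA_posDef)
open Literature.MathematicalPhysics.QuantumFieldTheory.Balaban1983to89.B5FiberDelta (dft_Lap)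

noncomputable section

variable {d : ℕ}

/-! ## §1 Symbol-agnostic algebra over the closed form (1.63) -/

section Agnostic

variable {ι : Type*} [Fintype ι] {κ : Type*} [Fintype κ]

/-- `T(p′) := Σ_λ \overline{∂¹_λ(p′)} B̃_λ(p′)/(Δ₀(p′)φ_λ(p′))` — the direction sum closing (1.63)
(`= Δ₀⁻¹·(∂₁*φ⁻¹B′)~(p′)`); it is literally the trailing factor of `B5Symbol163.second163`.
[cite: Balaban1984PropagatorsI, (1.63) p.28] -/
def tSum (Δ₀ : ℂ) (dOne phiDir Bt : κ → ℂ) : ℂ := ∑ lam, conj (dOne lam) / (Δ₀ * phiDir lam) * Bt lam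

/-- `g(p′) := Δ₀·N⁻¹·S⁻¹·T` — the symbol of `(Q′_kΔ⁻²Q′*_k)⁻¹λ′`, `λ′ = (∂₁*φ⁻¹∂₁)⁻¹∂₁*φ⁻¹B′` (p.27),
so that `(∂*H_kB)~(p′+l) = ū(p′+l)/Δ(p′+l)·g(p′)` (`div_second163`): `S = Σ_l|u|²Δ₀²/Δ²` (`sSym`),
`N = Σ_ν|∂¹_ν|²/(Δ₀²φ_ν)` (`nSym`). [cite: Balaban1984PropagatorsI, (1.60) p.28, p.27] -/
def gSym (u D : ι → ℂ) (Δ₀ : ℂ) (dOne phiDir Bt : κ → ℂ) : ℂ :=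
  Δ₀ * (nSym dOne phiDir Δ₀)⁻¹ * (sSym u D Δ₀)⁻¹ * tSum Δ₀ dOne phiDir Bt

/-- `w_μ(p′) := B̃_μ/φ_μ − ∂¹_μ·N⁻¹·T/(Δ₀φ_μ)` — the symbol of `φ⁻¹B′ − φ⁻¹∂₁λ′ = −ω` (p.27), the
coefficient of `\overline{u v_μ}(p′+l)` in `(Δ − ∂∂*)H̃_kB` (`lap_sub_grad_div_second163`).
[cite: Balaban1984PropagatorsI, p.27, (1.50) p.26] -/
def wSym (Δ₀ : ℂ) (dOne phiDir Bt : κ → ℂ) (μ : κ) : ℂ :=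
  Bt μ / phiDir μ - dOne μ * (nSym dOne phiDir Δ₀)⁻¹ * tSum Δ₀ dOne phiDir Bt / (Δ₀ * phiDir μ)

/-- the fibre symbol of `P = Δ⁻¹Q′*_k(Q′_kΔ⁻²Q′*_k)⁻¹Q′_kΔ⁻¹` ((1.38), cf. the last line of (1.35)) acting
on a fibre vector `ω`: `(Pω)(l) = ū(l)/Δ(l) · X⁻¹ · Σ_{l′} u(l′)/Δ(l′)·ω(l′)`, `X = Σ_{l′}|u(l′)|²/Δ(l′)²`
(the tree's `B5Momentum133.dft_PcT_apply_of_ne` has exactly this shape).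
[cite: Balaban1984PropagatorsI, (1.35) p.24, (1.38) p.24] -/
def pSym (u D : ι → ℂ) (ω : ι → ℂ) (l : ι) : ℂ :=
  conj (u l) / D l * ((∑ l', (normSq (u l') : ℂ) / D l' ^ 2)⁻¹ * ∑ l', u l' / D l' * ω l')

/-- `P` fixes every fibre vector of the shape `l ↦ ū(l)/Δ(l)·c` (the range `Δ⁻¹Q′*_k(·)`).
[cite: Balaban1984PropagatorsI, (1.38) p.24; p.25 «R is an orthogonal projection on … ΔN(Q′_k)»] -/
theorem pSym_range (u D : ι → ℂ) (c : ℂ) (hX : ∑ l', (normSq (u l') : ℂ) / D l' ^ 2 ≠ 0) (l : ι) :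
    pSym u D (fun l' => conj (u l') / D l' * c) l = conj (u l) / D l * c := by
  unfold pSym
  have h : ∑ l', u l' / D l' * (conj (u l') / D l' * c)
      = (∑ l', (normSq (u l') : ℂ) / D l' ^ 2) * c := by
    rw [Finset.sum_mul]
    refine Finset.sum_congr rfl fun l' _ => ?_
    rw [Complex.normSq_eq_conj_mul_self]
    ring
  rw [h, ← mul_assoc _⁻¹, inv_mul_cancel₀ hX, one_mul]

/-- hence `R = I − P` annihilates it: `(R s)(l) = 0` for `s(l) = ū(l)/Δ(l)·c`.
[cite: Balaban1984PropagatorsI, (1.38) p.24, (1.69) p.29 «R = I − P»] -/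
theorem rSym_range (u D : ι → ℂ) (c : ℂ) (hX : ∑ l', (normSq (u l') : ℂ) / D l' ^ 2 ≠ 0) (l : ι) :
    conj (u l) / D l * c - pSym u D (fun l' => conj (u l') / D l' * c) l = 0 := by
  rw [pSym_range u D c hX l, sub_self]

/-- `N ≠ 0` when the `φ_ν`, `Δ₀` are positive reals and some `∂¹_{ν₀} ≠ 0`. [folklore] -/
theorem nSym_ne_zero (dOne : κ → ℂ) (φr : κ → ℝ) (Δ₀r : ℝ) (hφ : ∀ ν, 0 < φr ν) (hΔ : 0 < Δ₀r)
    (ν₀ : κ) (hd : dOne ν₀ ≠ 0) : nSym dOne (fun ν => (φr ν : ℂ)) (Δ₀r : ℂ) ≠ 0 := by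
  have hcast : nSym dOne (fun ν => (φr ν : ℂ)) (Δ₀r : ℂ)
      = ((∑ ν, normSq (dOne ν) / (Δ₀r ^ 2 * φr ν) : ℝ) : ℂ) := by
    unfold nSym; push_cast; rfl
  rw [hcast, Complex.ofReal_ne_zero]
  have hpos : 0 < normSq (dOne ν₀) / (Δ₀r ^ 2 * φr ν₀) :=
    div_pos (Complex.normSq_pos.mpr hd) (mul_pos (pow_pos hΔ 2) (hφ ν₀))
  have hle : normSq (dOne ν₀) / (Δ₀r ^ 2 * φr ν₀) ≤ ∑ ν, normSq (dOne ν) / (Δ₀r ^ 2 * φr ν) :=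
    Finset.single_le_sum (f := fun ν => normSq (dOne ν) / (Δ₀r ^ 2 * φr ν))
      (fun ν _ => div_nonneg (Complex.normSq_nonneg _)
        (mul_nonneg (sq_nonneg _) (hφ ν).le)) (Finset.mem_univ ν₀)
  exact (hpos.trans_le hle).ne'

variable [DecidableEq ι]

/-- PER DIRECTION: `\overline{∂_μ(p′+l)}·(H̃_kB)_μ(l)` in closed form (from (1.63) with the closed inner
sum `sum_second_eq`, (1.61) «v_μ(p) = ∂¹_μ(p′)/∂_μ(p),» in the cleared form `∂¹_μ(p′) = v_μ(p)∂_μ(p)`, and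
`φ_μ` = (1.62)). [folklore] -/
theorem conj_d_mul_second163 (u : ι → ℂ) (vv dd : κ → ι → ℂ) (D : ι → ℂ) (Δ₀ : ℂ)
    (dOne phiDir Bt : κ → ℂ) (l : ι) (μ : κ) (hΔ : Δ₀ ≠ 0) (hS : sSym u D Δ₀ ≠ 0)
    (hN : nSym dOne phiDir Δ₀ ≠ 0) (hφ : phiSym u (vv μ) D = phiDir μ) (hφ0 : phiDir μ ≠ 0)
    (h161 : dOne μ = vv μ l * dd μ l) (hDl : D l ≠ 0) :
    conj (dd μ l) * second163 u (vv μ) (dd μ) D Δ₀ dOne phiDir Bt μ l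
      = conj (u l) / D l * (conj (dOne μ) / phiDir μ * Bt μ)
        + conj (u l) * (nSym dOne phiDir Δ₀)⁻¹ * tSum Δ₀ dOne phiDir Bt
          * ((normSq (dd μ l) : ℂ) * Δ₀ / (D l ^ 2 * sSym u D Δ₀)
              - (normSq (dOne μ) : ℂ) / (D l * Δ₀ * phiDir μ)) := by
  rw [second163, head163, sum_erase_eq_sum, sum_second_eq, hφ,
    show (∑ lam, conj (dOne lam) / (Δ₀ * phiDir lam) * Bt lam) = tSum Δ₀ dOne phiDir Bt from rfl]
  have e1 : conj (dOne μ) = conj (vv μ l) * conj (dd μ l) := by rw [h161, map_mul]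
  have e2 : (normSq (dOne μ) : ℂ) = (normSq (vv μ l) : ℂ) * (normSq (dd μ l) : ℂ) := by
    rw [h161, Complex.normSq_mul, Complex.ofReal_mul]
  have e3 : (normSq (dd μ l) : ℂ) = conj (dd μ l) * dd μ l := Complex.normSq_eq_conj_mul_self
  rw [e1, e2, e3, map_mul]
  field_simp

/-- **`(∂*H_kB)~(p′+l) = ū(p′+l)/Δ(p′+l)·g(p′)`** (symbol-agnostic form): contracting (1.63) with
`\overline{∂_μ(p′+l)}` and summing over `μ`, using «Δ(p) = Σ_μ|∂_μ(p)|²» ((1.31)) and (1.61); the result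
lies in the range `Δ⁻¹Q′*_k(·)` of `P` — the content of «R∂*H_kB = 0».
[cite: Balaban1984PropagatorsI, p.29 «R∂*H_kB = 0» (text); (1.60)–(1.63) p.28] -/
theorem div_second163 (u : ι → ℂ) (vv dd : κ → ι → ℂ) (D : ι → ℂ) (Δ₀ : ℂ)
    (dOne phiDir Bt : κ → ℂ) (l : ι) (hΔ : Δ₀ ≠ 0) (hS : sSym u D Δ₀ ≠ 0)
    (hN : nSym dOne phiDir Δ₀ ≠ 0) (hφ : ∀ μ, phiSym u (vv μ) D = phiDir μ) (hφ0 : ∀ μ, phiDir μ ≠ 0)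
    (h161 : ∀ μ, dOne μ = vv μ l * dd μ l) (hD : D l = ∑ μ, (normSq (dd μ l) : ℂ)) (hDl : D l ≠ 0) :
    ∑ μ, conj (dd μ l) * second163 u (vv μ) (dd μ) D Δ₀ dOne phiDir Bt μ l
      = conj (u l) / D l * gSym u D Δ₀ dOne phiDir Bt := by
  rw [Finset.sum_congr rfl (fun μ _ => conj_d_mul_second163 u vv dd D Δ₀ dOne phiDir Bt l μ hΔ hS hN
    (hφ μ) (hφ0 μ) (h161 μ) hDl), Finset.sum_add_distrib, ← Finset.mul_sum, ← Finset.mul_sum,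
    Finset.sum_sub_distrib]
  have hT : ∑ μ, conj (dOne μ) / phiDir μ * Bt μ = Δ₀ * tSum Δ₀ dOne phiDir Bt := by
    rw [tSum, Finset.mul_sum]
    refine Finset.sum_congr rfl fun μ _ => ?_
    have := hφ0 μ
    field_simp
  have hY : ∑ μ, (normSq (dd μ l) : ℂ) * Δ₀ / (D l ^ 2 * sSym u D Δ₀)
      = D l * (Δ₀ / (D l ^ 2 * sSym u D Δ₀)) := by
    simp_rw [mul_div_assoc]
    rw [← Finset.sum_mul, ← hD]
  have hZ : ∑ μ, (normSq (dOne μ) : ℂ) / (D l * Δ₀ * phiDir μ) = Δ₀ / D l * nSym dOne phiDir Δ₀ := by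
    rw [nSym, Finset.mul_sum]
    refine Finset.sum_congr rfl fun μ _ => ?_
    have := hφ0 μ
    field_simp
  rw [hT, hY, hZ, gSym]
  field_simp
  ring

/-- **`(Δ − ∂∂*)H̃_kB` is in the range of `Q_k*` fibrewise**: per `l` and direction `μ`,
`Δ(p′+l)·(H̃_kB)_μ(l) − ∂_μ(p′+l)·(∂*H_kB)~(p′+l) = \overline{u(p′+l)v_μ(p′+l)}·w_μ(p′)` — the
algebraic core of the THIRD property of p.29 (`H_kB` minimises `½⟨∂A,∂A⟩` on `{Q_kA = B, R∂*A = 0}`,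
i.e. the Euler–Lagrange equation (1.50) with `λ = 0` and `P∂*A = ∂*A`).
[cite: Balaban1984PropagatorsI, p.29 (text); (1.50) p.26; (1.63) p.28] -/
theorem lap_sub_grad_div_second163 (u : ι → ℂ) (vv dd : κ → ι → ℂ) (D : ι → ℂ) (Δ₀ : ℂ)
    (dOne phiDir Bt : κ → ℂ) (l : ι) (μ : κ) (hΔ : Δ₀ ≠ 0) (hS : sSym u D Δ₀ ≠ 0)
    (hN : nSym dOne phiDir Δ₀ ≠ 0) (hφ : phiSym u (vv μ) D = phiDir μ) (hφ0 : phiDir μ ≠ 0)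
    (h161 : dOne μ = vv μ l * dd μ l) (hDl : D l ≠ 0) :
    D l * second163 u (vv μ) (dd μ) D Δ₀ dOne phiDir Bt μ l
        - dd μ l * (conj (u l) / D l * gSym u D Δ₀ dOne phiDir Bt)
      = conj (u l * vv μ l) * wSym Δ₀ dOne phiDir Bt μ := by
  rw [second163, head163, sum_erase_eq_sum, sum_second_eq, hφ,
    show (∑ lam, conj (dOne lam) / (Δ₀ * phiDir lam) * Bt lam) = tSum Δ₀ dOne phiDir Bt from rfl,
    gSym, wSym, map_mul, h161]
  have e : (normSq (vv μ l) : ℂ) = conj (vv μ l) * vv μ l := Complex.normSq_eq_conj_mul_self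
  rw [e]
  field_simp
  ring

end Agnostic

/-! ## §2 The torus leaves `p′ = sOf q` of B5's data -/

section Torus

variable (n : ℕ) [NeZero n]

/-- `g(p′)` of `gSym` ON B5's DATA at the real coarse momentum `p′ = s`. [folklore] -/
def gT (s : Fin d → ℝ) (Bt : Fin d → ℂ) : ℂ :=
  gSym (fun l : Fin d → Fin n => uSym n l s) (fun l => ((DeltaXir n 0 (shiftr n l s) : ℝ) : ℂ))
    ((Delta1r 0 s : ℝ) : ℂ) (d1Sym s) (fun ν => ((phi162 n ν s : ℝ) : ℂ)) Bt

/-- `w_μ(p′)` of `wSym` ON B5's DATA at the real coarse momentum `p′ = s`. [folklore] -/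
def wT (s : Fin d → ℝ) (Bt : Fin d → ℂ) (μ : Fin d) : ℂ :=
  wSym ((Delta1r 0 s : ℝ) : ℂ) (d1Sym s) (fun ν => ((phi162 n ν s : ℝ) : ℂ)) Bt μ

omit [NeZero n] in
/-- `∂¹_ν(p′) ≠ 0` when `p′_ν ≠ 0`, `|p′_ν| ≤ π` (`|∂¹_ν|² = S1r(p′_ν) > 0`, `B5Symbol166.S1r_pos_of_ne`).
[folklore] -/
theorem d1Sym_ne_zero (s : Fin d → ℝ) (hs : ∀ ν, |s ν| ≤ Real.pi) (ν₀ : Fin d) (hν₀ : s ν₀ ≠ 0) :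
    d1Sym s ν₀ ≠ 0 := by
  intro h
  have h1 : S1r (s ν₀) = 0 := by
    rw [← norm_d1Sym_sq, h, norm_zero]
    norm_num
  linarith [S1r_pos_of_ne (hs ν₀) hν₀]

/-- **`(∂*H_kB)~(p′+l) = ū(p′+l)/Δ(p′+l)·g(p′)` ON THE TORUS LEAVES `p′ ≠ 0`**:
`Σ_μ \overline{∂_μ(p′+l)} Σ_λ h163_{μλ}(l;p′) B̃_λ = \overline{u_k(p′+l)}/Δ(p′+l) · g(p′)`, every `n ≥ 1`.
[cite: Balaban1984PropagatorsI, p.29 «R∂*H_kB = 0» (text); (1.61)–(1.63) p.28] -/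
theorem div_sum_h163 (hn : 1 ≤ n) (s : Fin d → ℝ) (hs : ∀ ν, |s ν| ≤ Real.pi) (ν₀ : Fin d)
    (hν₀ : s ν₀ ≠ 0) (k : Fin d → Fin n) (Bt : Fin d → ℂ) :
    ∑ μ, conj (dSym n k s μ) * ∑ lam, h163 n μ lam k (ofRealVec s) * Bt lam
      = conj (uSym n k s) / ((DeltaXir n 0 (shiftr n k s) : ℝ) : ℂ) * gT n s Bt := by
  have e : ∀ μ, ∑ lam, h163 n μ lam k (ofRealVec s) * Bt lam
      = second163 (fun l : Fin d → Fin n => uSym n l s) (fun l => vSym n l s μ) (fun l => dSym n l s μ)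
          (fun l => ((DeltaXir n 0 (shiftr n l s) : ℝ) : ℂ)) ((Delta1r 0 s : ℝ) : ℂ) (d1Sym s)
          (fun ν => ((phi162 n ν s : ℝ) : ℂ)) Bt μ k :=
    fun μ => (second163_eq_sum_h163 n hn s hs ν₀ hν₀ μ k Bt).symm
  rw [sum_congr rfl (fun μ _ => by rw [e μ])]
  have hΔr := Delta1r_pos s hs ν₀ hν₀
  have hDr : ∀ l : Fin d → Fin n, 0 < DeltaXir n 0 (shiftr n l s) :=
    fun l => hΔr.trans_le (Delta1r_le_DeltaXir_shift n hn l s)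
  have hφr : ∀ μ, 0 < phi162 n μ s := fun μ => phi162_pos n hn μ s hs ν₀ hν₀
  have huv := uSym_vSym_zero_ne_zero n hn s hs ν₀
  have hD : ((DeltaXir n 0 (shiftr n k s) : ℝ) : ℂ) = ∑ μ, ((normSq (dSym n k s μ) : ℝ) : ℂ) := by
    rw [Delta_eq, Complex.ofReal_sum]
    exact Finset.sum_congr rfl fun μ _ => by rw [Complex.normSq_eq_norm_sq]
  exact div_second163 (fun l : Fin d → Fin n => uSym n l s) (fun μ l => vSym n l s μ)
    (fun μ l => dSym n l s μ) (fun l => ((DeltaXir n 0 (shiftr n l s) : ℝ) : ℂ)) ((Delta1r 0 s : ℝ) : ℂ)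
    (d1Sym s) (fun ν => ((phi162 n ν s : ℝ) : ℂ)) Bt k (Complex.ofReal_ne_zero.mpr hΔr.ne')
    (sSym_ne_zero _ (fun l => DeltaXir n 0 (shiftr n l s)) (Delta1r 0 s) hDr hΔr (fun _ => 0) huv.1)
    (nSym_ne_zero (d1Sym s) (fun ν => phi162 n ν s) (Delta1r 0 s) hφr hΔr ν₀ (d1Sym_ne_zero s hs ν₀ hν₀))
    (fun μ => phiSym_ofReal n s μ) (fun μ => Complex.ofReal_ne_zero.mpr (hφr μ).ne')
    (fun μ => d1Sym_eq_vSym_mul n hn k s μ) hD (Complex.ofReal_ne_zero.mpr (hDr k).ne')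

/-- the companion ON THE TORUS LEAVES `p′ ≠ 0`: `Δ(p′+l)·Σ_λ h163_{μλ}(l;p′)B̃_λ −
∂_μ(p′+l)·\overline{u_k(p′+l)}/Δ(p′+l)·g(p′) = \overline{u_k v_μ}(p′+l)·w_μ(p′)`.
[cite: Balaban1984PropagatorsI, p.29 (text); (1.50) p.26; (1.63) p.28] -/
theorem lap_sub_grad_div_h163 (hn : 1 ≤ n) (s : Fin d → ℝ) (hs : ∀ ν, |s ν| ≤ Real.pi) (ν₀ : Fin d)
    (hν₀ : s ν₀ ≠ 0) (k : Fin d → Fin n) (Bt : Fin d → ℂ) (μ : Fin d) :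
    ((DeltaXir n 0 (shiftr n k s) : ℝ) : ℂ) * ∑ lam, h163 n μ lam k (ofRealVec s) * Bt lam
        - dSym n k s μ * (conj (uSym n k s) / ((DeltaXir n 0 (shiftr n k s) : ℝ) : ℂ) * gT n s Bt)
      = conj (uSym n k s * vSym n k s μ) * wT n s Bt μ := by
  rw [← second163_eq_sum_h163 n hn s hs ν₀ hν₀ μ k Bt]
  have hΔr := Delta1r_pos s hs ν₀ hν₀
  have hDr : ∀ l : Fin d → Fin n, 0 < DeltaXir n 0 (shiftr n l s) :=
    fun l => hΔr.trans_le (Delta1r_le_DeltaXir_shift n hn l s)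
  have hφr : ∀ μ, 0 < phi162 n μ s := fun μ => phi162_pos n hn μ s hs ν₀ hν₀
  have huv := uSym_vSym_zero_ne_zero n hn s hs ν₀
  exact lap_sub_grad_div_second163 (fun l : Fin d → Fin n => uSym n l s) (fun μ l => vSym n l s μ)
    (fun μ l => dSym n l s μ) (fun l => ((DeltaXir n 0 (shiftr n l s) : ℝ) : ℂ)) ((Delta1r 0 s : ℝ) : ℂ)
    (d1Sym s) (fun ν => ((phi162 n ν s : ℝ) : ℂ)) Bt k μ (Complex.ofReal_ne_zero.mpr hΔr.ne')
    (sSym_ne_zero _ (fun l => DeltaXir n 0 (shiftr n l s)) (Delta1r 0 s) hDr hΔr (fun _ => 0) huv.1)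
    (nSym_ne_zero (d1Sym s) (fun ν => phi162 n ν s) (Delta1r 0 s) hφr hΔr ν₀ (d1Sym_ne_zero s hs ν₀ hν₀))
    (phiSym_ofReal n s μ) (Complex.ofReal_ne_zero.mpr (hφr μ).ne') (d1Sym_eq_vSym_mul n hn k s μ)
    (Complex.ofReal_ne_zero.mpr (hDr k).ne')

/-- zero fibre, `l = 0`: `∂_μ(0) = 0`. [folklore] -/
theorem dSym_zero_zero (μ : Fin d) : dSym n (fun _ => (0 : Fin n)) (0 : Fin d → ℝ) μ = 0 := by
  simp [dSym, shiftr]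

/-- zero fibre, `l ≠ 0`: the kernel entries vanish, `h163_{μλ}(l; 0) = 0` (`Δ(0) = 0` kills the head's
`ρ = Δ(p′)/Δ(p′+l)`, `e^{-i·0} − 1 = 0` kills the tail). [folklore] -/
theorem h163_zero_of_ne (μ lam : Fin d) {k : Fin d → Fin n} (hk : k ≠ fun _ => 0) :
    h163 n μ lam k (0 : Fin d → ℂ) = 0 := by
  have hrho : rho n k (0 : Fin d → ℂ) = 0 := by
    rw [rho, if_neg hk, DeltaXi_zero163, zero_div]
  have hg : gdir n lam (0 : Fin d → ℂ) = 0 := by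
    simp [gdir, expFacNeg]
  simp [h163, headC, hrho, hg]

/-- **zero fibre**: `(∂*H_kB)~(l) = 0` at `p′ = 0`, every `l`. [folklore] -/
theorem div_sum_h163_zero (k : Fin d → Fin n) (Bt : Fin d → ℂ) :
    ∑ μ, conj (dSym n k 0 μ) * ∑ lam, h163 n μ lam k (ofRealVec 0) * Bt lam = 0 := by
  rw [ofRealVec_zero]
  by_cases hk : k = fun _ => 0
  · subst hk
    simp [dSym_zero_zero]
  · simp [h163_zero_of_ne n _ _ hk]

/-- **zero fibre**, companion: `Δ(l)·(H̃_kB)_μ(l) = 0` at `p′ = 0`, every `l`. [folklore] -/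
theorem lap_sum_h163_zero (k : Fin d → Fin n) (Bt : Fin d → ℂ) (μ : Fin d) :
    ((DeltaXir n 0 (shiftr n k 0) : ℝ) : ℂ) * ∑ lam, h163 n μ lam k (ofRealVec 0) * Bt lam = 0 := by
  rw [ofRealVec_zero]
  by_cases hk : k = fun _ => 0
  · subst hk
    have h0 : DeltaXir n 0 (shiftr n (fun _ => (0 : Fin n)) (0 : Fin d → ℝ)) = 0 := by
      rw [Delta_eq]
      simp [dSym_zero_zero]
    rw [h0, Complex.ofReal_zero, zero_mul]
  · simp [h163_zero_of_ne n _ _ hk]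

end Torus

/-! ## §3 The operator statement: «R∂*H_kB = 0» -/

section Operator

variable (n : ℕ) [NeZero n] (M : Fin d → ℕ) [hM : ∀ μ, NeZero (M μ)]

/-- the momentum representation of `∂*H_kB` on the fibre `p = p′ + l`:
`(∂*H_kB)~(p′+l) = c_Q⁻¹ Σ_μ \overline{∂_μ(p′+l)} Σ_λ h163_{μλ}(l;p′) B̂_λ(p′)` — «(∂*A)~(p) =
Σ_μ \overline{∂_μ(p)} Ã_μ(p)» (p.24) with `dft_HkOp`. [cite: Balaban1984PropagatorsI, p.24 (text); (1.63) p.28] -/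
theorem dft_divS_HkOp (B : Tor M × Fin d → ℂ) (k : Fin d → Fin n) (q : Tor M) :
    (dft (fine n M) *ᵥ ((GradOp (fine n M) (n : ℂ))ᴴ *ᵥ (HkOp n M *ᵥ B))) (pOf n M (k, q))
      = ((cQ n M : ℂ))⁻¹ * ∑ μ, conj (dSym n k (sOf M q) μ)
          * ∑ lam, h163 n μ lam k (ofRealVec (sOf M q)) * (dft M *ᵥ comp M B lam) q := by
  rw [dft_GradOp_adjoint, Finset.mul_sum]
  refine Finset.sum_congr rfl fun μ _ => ?_
  rw [ssym_pOf, dft_HkOp]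
  ring

/-- `(∂*H_kB)~(p′+l) = c_Q⁻¹ · \overline{u_k(p′+l)}/Δ(p′+l) · g(p′)` for `p′ ≠ 0`.
[cite: Balaban1984PropagatorsI, p.29 «R∂*H_kB = 0» (text); (1.60) p.28] -/
theorem dft_divS_HkOp_of_ne (B : Tor M × Fin d → ℂ) (k : Fin d → Fin n) {q : Tor M} (hq : q ≠ 0) :
    (dft (fine n M) *ᵥ ((GradOp (fine n M) (n : ℂ))ᴴ *ᵥ (HkOp n M *ᵥ B))) (pOf n M (k, q))
      = ((cQ n M : ℂ))⁻¹ * (conj (uSym n k (sOf M q)) / lsym (fine n M) (n : ℂ) (pOf n M (k, q))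
          * gT n (sOf M q) (fun lam => (dft M *ᵥ comp M B lam) q)) := by
  have hn : 1 ≤ n := Nat.one_le_iff_ne_zero.mpr (NeZero.ne n)
  obtain ⟨ν₀, hν₀⟩ := Function.ne_iff.mp (sOf_ne_zero M hq)
  rw [dft_divS_HkOp, div_sum_h163 n hn (sOf M q) (abs_sOf_le M q) ν₀ hν₀ k _, lsym_pOf]

/-- `(∂*H_kB)~(l) = 0` on the zero fibre `p′ = 0`. [folklore] -/
theorem dft_divS_HkOp_zero (B : Tor M × Fin d → ℂ) (k : Fin d → Fin n) :
    (dft (fine n M) *ᵥ ((GradOp (fine n M) (n : ℂ))ᴴ *ᵥ (HkOp n M *ᵥ B))) (pOf n M (k, 0)) = 0 := by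
  rw [dft_divS_HkOp, sOf_zero, div_sum_h163_zero, mul_zero]

/-- **`P∂*H_kB = ∂*H_kB`**: the divergence of `H_kB` lies in the range of the projection
`P = Δ⁻¹Q′*_k(Q′_kΔ⁻²Q′*_k)⁻¹Q′_kΔ⁻¹` ((1.38)/(1.70), the tree's `B5Value126.PcT`).
[cite: Balaban1984PropagatorsI, p.29 «R∂*H_kB = 0» (text); (1.38) p.24; (1.60)–(1.63) p.28] -/
theorem PcT_divS_HkOp (B : Tor M × Fin d → ℂ) :
    PcT n M (n : ℂ) *ᵥ ((GradOp (fine n M) (n : ℂ))ᴴ *ᵥ (HkOp n M *ᵥ B))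
      = (GradOp (fine n M) (n : ℂ))ᴴ *ᵥ (HkOp n M *ᵥ B) := by
  have hnc : (n : ℂ) ≠ 0 := by exact_mod_cast NeZero.ne n
  apply dft_mulVec_injective (fine n M)
  funext p
  obtain ⟨⟨k, q⟩, rfl⟩ := (pOf_bijective n M).2 p
  show (dft (fine n M) *ᵥ (PcT n M (n : ℂ) *ᵥ _)) (pOf n M (k, q)) = (dft (fine n M) *ᵥ _) (pOf n M (k, q))
  by_cases hq : q = 0
  · subst hq
    rw [dft_PcT_zero_fiber, dft_divS_HkOp_zero]
  · rw [dft_PcT_apply_of_ne n M (n : ℂ) hnc _ k hq, dft_divS_HkOp_of_ne n M B k hq]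
    have hBs : Bs n M (n : ℂ) ((GradOp (fine n M) (n : ℂ))ᴴ *ᵥ (HkOp n M *ᵥ B)) q
        = ((cQ n M : ℂ))⁻¹ * gT n (sOf M q) (fun lam => (dft M *ᵥ comp M B lam) q)
            * Xs n M (n : ℂ) q := by
      rw [Bs, Xs, Finset.mul_sum]
      refine Finset.sum_congr rfl fun k' _ => ?_
      rw [dft_divS_HkOp_of_ne n M B k' hq, Complex.ofReal_pow, ← Complex.mul_conj']
      have hl := lsym_pOf_ne_zero n M (n : ℂ) hnc k' hq
      field_simp
    rw [hBs]
    have hX := Xs_ne_zero n M (n : ℂ) hnc hq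
    have hl := lsym_pOf_ne_zero n M (n : ℂ) hnc k hq
    field_simp

/-- **THE SECOND PROPERTY OF p.29: «R∂*H_kB = 0»**, `R = I − P` ((1.38), (1.69)), for the typed torus
operator `H_k` of `B5Hk163Torus` and every coarse field `B`.
[cite: Balaban1984PropagatorsI, p.29 «R∂*H_kB = 0» (text); (1.38) p.24; (1.69) p.29 «R = I − P»] -/
theorem R_divS_HkOp (B : Tor M × Fin d → ℂ) :
    (1 - PcT n M (n : ℂ)) *ᵥ ((GradOp (fine n M) (n : ℂ))ᴴ *ᵥ (HkOp n M *ᵥ B)) = 0 := by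
  rw [Matrix.sub_mulVec, Matrix.one_mulVec, PcT_divS_HkOp, sub_self]

/-- the same with the divergence written as `divS` (`∂* = (∂)ᴴ`, `B5Action121.GradOp_conjTranspose_mulVec_eq`).
[cite: Balaban1984PropagatorsI, p.29 «R∂*H_kB = 0» (text); (1.21) p.21] -/
theorem R_divS_HkOp' (B : Tor M × Fin d → ℂ) :
    (1 - PcT n M (n : ℂ)) *ᵥ divS (fine n M) (n : ℂ) (HkOp n M *ᵥ B) = 0 := by
  rw [← GradOp_conjTranspose_mulVec_eq, R_divS_HkOp]

/-- **«R∂*H_kB = 0» as an operator identity**: `R · ∂* · H_k = 0`.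
[cite: Balaban1984PropagatorsI, p.29 «R∂*H_kB = 0» (text); (1.38) p.24; (1.69) p.29] -/
theorem R_mul_divS_mul_HkOp :
    (1 - PcT n M (n : ℂ)) * (GradOp (fine n M) (n : ℂ))ᴴ * HkOp n M = 0 := by
  refine Matrix.ext_of_mulVec_single fun i => ?_
  rw [← Matrix.mulVec_mulVec, ← Matrix.mulVec_mulVec, R_divS_HkOp, Matrix.zero_mulVec]

end Operator

/-! ## §4 The third property: `(Δ − ∂∂*)H_kB ⊥ N(Q_k)`, and `H_kB` minimises `½⟨∂A,∂A⟩` on `{Q_kA = B}` -/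

section Minimum

open Matrix

variable (n : ℕ) [NeZero n] (M : Fin d → ℕ) [hM : ∀ μ, NeZero (M μ)]

/-- `∂*∂ = Δ − ∂∂*` ((1.69) «Δ = ∂*∂ + ∂∂*»): the operator of the quadratic form «⟨∂A, ∂A⟩ =
½ Σ_{x∈T_η,μ,ν} η^d|F_{μν}(x)|²» ((1.21)), with the componentwise `Δ = Σ_ν∇_ν*∇_ν` of passes 4–6
(`B5Prop11Lower.Lap` = `B5Action121.LapV`; `B5Action121.form_curl_eq`: `⟨A, (Δ − ∂∂*)A⟩ = ½Σ|F_{μν}|²`,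
`B5Action121.curl_adjoint_curl`: `(CurlOp)ᴴ·CurlOp = 2(Δ − ∂∂*)`).
[cite: Balaban1984PropagatorsI, (1.21) p.21, (1.69) p.29] -/
def DstarD : Matrix (Tor (fine n M) × Fin d) (Tor (fine n M) × Fin d) ℂ :=
  Lap n M - GradOp (fine n M) (n : ℂ) * (GradOp (fine n M) (n : ℂ))ᴴ

/-- `⟨A, (Δ − ∂∂*)A⟩ = ½ Σ_{x,μ,ν}|F_{μν}(x)|²` (`B5Action121.form_curl_eq` for `N = fine n M`, `c = n`).
[cite: Balaban1984PropagatorsI, (1.21) p.21] -/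
theorem form_DstarD (A : Tor (fine n M) × Fin d → ℂ) :
    star A ⬝ᵥ (DstarD n M *ᵥ A)
      = ((((1 / 2 : ℝ) * ∑ x, ∑ μ, ∑ ν, ‖Fs (fine n M) (n : ℂ) A μ ν x‖ ^ 2 : ℝ)) : ℂ) :=
  (form_curl_eq (fine n M) (n : ℂ) A).symm

/-- `Δ − ∂∂*` is Hermitian. [folklore] -/
theorem DstarD_conjTranspose : (DstarD n M)ᴴ = DstarD n M := by
  rw [DstarD, Lap_eq_LapV, LapV, Matrix.conjTranspose_sub, Matrix.conjTranspose_sum]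
  simp_rw [Matrix.conjTranspose_mul, Matrix.conjTranspose_conjTranspose]

/-- Parseval for the componentwise DFT (it is unitary, `B5Prop11Plancherel.star_dftV_mul`).
[folklore] -/
theorem parseval_dftV (f g : Tor (fine n M) × Fin d → ℂ) :
    star (dftV (fine n M) *ᵥ f) ⬝ᵥ (dftV (fine n M) *ᵥ g) = star f ⬝ᵥ g := by
  rw [star_mulVec_dotProduct, Matrix.mulVec_mulVec, ← Matrix.star_eq_conjTranspose, star_dftV_mul,
    Matrix.one_mulVec]

/-- the momentum representation of `(Δ − ∂∂*)H_kB` on the fibre `p = p′ + l`: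
`((Δ − ∂∂*)H_kB)~_κ(p′+l) = c_Q⁻¹·Δ(p′+l)·Σ_λ h163_{κλ}(l;p′)B̂_λ(p′) − ∂_κ(p′+l)·(∂*H_kB)~(p′+l)` —
«Δ(p) = Σ_μ|∂_μ(p)|²» (`B5FiberDelta.dft_Lap`) and the symbol `∂_κ(p)` of the gradient
(`B5DeltaA169.dft_comp_GradOp`). [cite: Balaban1984PropagatorsI, (1.31) p.23, (1.69) p.29] -/
theorem dftV_DstarD_HkOp (B : Tor M × Fin d → ℂ) (k : Fin d → Fin n) (q : Tor M) (κ : Fin d) :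
    (dftV (fine n M) *ᵥ (DstarD n M *ᵥ (HkOp n M *ᵥ B))) (pOf n M (k, q), κ)
      = ((cQ n M : ℂ))⁻¹ * (((DeltaXir n 0 (shiftr n k (sOf M q)) : ℝ) : ℂ)
            * ∑ lam, h163 n κ lam k (ofRealVec (sOf M q)) * (dft M *ᵥ comp M B lam) q)
        - dSym n k (sOf M q) κ
            * (dft (fine n M) *ᵥ ((GradOp (fine n M) (n : ℂ))ᴴ *ᵥ (HkOp n M *ᵥ B))) (pOf n M (k, q)) := by
  rw [DstarD, Matrix.sub_mulVec, Matrix.mulVec_sub, Pi.sub_apply, dft_Lap, ← Delta_eq,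
    B5DeltaA169.dftV_mulVec_apply, B5DeltaA169.dftV_mulVec_apply, dft_HkOp, ← Matrix.mulVec_mulVec,
    dft_comp_GradOp, ssym_pOf]
  ring

/-- … hence, for `p′ ≠ 0`: `((Δ − ∂∂*)H_kB)~_κ(p′+l) = c_Q⁻¹·\overline{u_k(p′+l) v_κ(p′+l)}·w_κ(p′)` — it lies
in the range of `Q_k*` (whose symbol is `\overline{u v_κ}`, (1.61)).
[cite: Balaban1984PropagatorsI, p.29 (text); (1.50) p.26; (1.61)–(1.63) p.28] -/
theorem dftV_DstarD_HkOp_of_ne (B : Tor M × Fin d → ℂ) (k : Fin d → Fin n) {q : Tor M} (hq : q ≠ 0)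
    (κ : Fin d) :
    (dftV (fine n M) *ᵥ (DstarD n M *ᵥ (HkOp n M *ᵥ B))) (pOf n M (k, q), κ)
      = ((cQ n M : ℂ))⁻¹ * (conj (uSym n k (sOf M q) * vSym n k (sOf M q) κ)
          * wT n (sOf M q) (fun lam => (dft M *ᵥ comp M B lam) q) κ) := by
  have hn : 1 ≤ n := Nat.one_le_iff_ne_zero.mpr (NeZero.ne n)
  obtain ⟨ν₀, hν₀⟩ := Function.ne_iff.mp (sOf_ne_zero M hq)
  rw [dftV_DstarD_HkOp, dft_divS_HkOp_of_ne n M B k hq, lsym_pOf,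
    ← lap_sub_grad_div_h163 n hn (sOf M q) (abs_sOf_le M q) ν₀ hν₀ k _ κ]
  ring

/-- … and `((Δ − ∂∂*)H_kB)~_κ(l) = 0` on the zero fibre `p′ = 0`. [folklore] -/
theorem dftV_DstarD_HkOp_zero (B : Tor M × Fin d → ℂ) (k : Fin d → Fin n) (κ : Fin d) :
    (dftV (fine n M) *ᵥ (DstarD n M *ᵥ (HkOp n M *ᵥ B))) (pOf n M (k, 0), κ) = 0 := by
  rw [dftV_DstarD_HkOp, dft_divS_HkOp_zero, mul_zero, sub_zero, sOf_zero, lap_sum_h163_zero, mul_zero]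

/-- **«⟨∂A′, ∂H_kB⟩ = 0 on the subspace {A′ : Q_kA′ = 0, …}»** — in fact on all of `N(Q_k)`:
`⟨A′, (Δ − ∂∂*)H_kB⟩ = 0` whenever `Q_kA′ = 0` (the weak Euler–Lagrange equation (1.50) of the
variational problem (1.47), with `λ = 0` and `P∂*H_kB = ∂*H_kB`).  Proof: Parseval, the fibrewise
range statement `dftV_DstarD_HkOp_of_ne` and the momentum form (1.61) of the constraint (`dft_QvOp`).
[cite: Balaban1984PropagatorsI, p.29 (text); (1.47), (1.50) p.26; (1.61) p.28] -/
theorem form_DstarD_HkOp_eq_zero (B : Tor M × Fin d → ℂ) (A' : Tor (fine n M) × Fin d → ℂ)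
    (hA : QvOp n M *ᵥ A' = 0) : star A' ⬝ᵥ (DstarD n M *ᵥ (HkOp n M *ᵥ B)) = 0 := by
  have hcQ := cQ_ne_zero n M
  -- the constraint in momentum space: `Σ_l u(p′+l) v_κ(p′+l) Â′_κ(p′+l) = 0`
  have hQ : ∀ (q : Tor M) (κ : Fin d), ∑ k : Fin d → Fin n, uSym n k (sOf M q) * vSym n k (sOf M q) κ
      * (dft (fine n M) *ᵥ comp (fine n M) A' κ) (pOf n M (k, q)) = 0 := by
    intro q κ
    have h := dft_QvOp n M A' q κ
    have h0 : comp M (QvOp n M *ᵥ A') κ = 0 := by rw [hA]; rfl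
    rw [h0, Matrix.mulVec_zero, Pi.zero_apply] at h
    exact (mul_eq_zero.mp h.symm).resolve_left hcQ
  set F := DstarD n M *ᵥ (HkOp n M *ᵥ B) with hF
  rw [← parseval_dftV n M A' F]
  calc star (dftV (fine n M) *ᵥ A') ⬝ᵥ (dftV (fine n M) *ᵥ F)
      = ∑ I, star (dftV (fine n M) *ᵥ A') I * (dftV (fine n M) *ᵥ F) I := rfl
    _ = ∑ J, star (dftV (fine n M) *ᵥ A') (B5Prop11Plancherel.emb n M J)
          * (dftV (fine n M) *ᵥ F) (B5Prop11Plancherel.emb n M J) :=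
        (Fintype.sum_bijective (B5Prop11Plancherel.emb n M) (B5Prop11Plancherel.emb_bijective n M) _ _
          (fun _ => rfl)).symm
    _ = ∑ kκ : (Fin d → Fin n) × Fin d, ∑ q : Tor M, star (dftV (fine n M) *ᵥ A') (pOf n M (kκ.1, q), kκ.2)
          * (dftV (fine n M) *ᵥ F) (pOf n M (kκ.1, q), kκ.2) := by
        rw [Fintype.sum_prod_type]
        rfl
    _ = ∑ q : Tor M, ∑ kκ : (Fin d → Fin n) × Fin d, star (dftV (fine n M) *ᵥ A') (pOf n M (kκ.1, q), kκ.2)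
          * (dftV (fine n M) *ᵥ F) (pOf n M (kκ.1, q), kκ.2) := Finset.sum_comm
    _ = 0 := by
        refine Finset.sum_eq_zero fun q _ => ?_
        rcases eq_or_ne q 0 with rfl | hq
        · refine Finset.sum_eq_zero fun kκ _ => ?_
          rw [hF, dftV_DstarD_HkOp_zero, mul_zero]
        · rw [Fintype.sum_prod_type, Finset.sum_comm]
          refine Finset.sum_eq_zero fun κ _ => ?_
          have h1 : ∀ k : Fin d → Fin n,
              star (dftV (fine n M) *ᵥ A') (pOf n M (k, q), κ) * (dftV (fine n M) *ᵥ F) (pOf n M (k, q), κ)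
                = ((cQ n M : ℂ))⁻¹ * wT n (sOf M q) (fun lam => (dft M *ᵥ comp M B lam) q) κ
                    * conj (uSym n k (sOf M q) * vSym n k (sOf M q) κ
                        * (dft (fine n M) *ᵥ comp (fine n M) A' κ) (pOf n M (k, q))) := by
            intro k
            rw [hF, dftV_DstarD_HkOp_of_ne n M B k hq κ, Pi.star_apply, B5DeltaA169.dftV_mulVec_apply,
              RCLike.star_def]
            simp only [map_mul]
            ring
          rw [Finset.sum_congr rfl (fun k _ => h1 k), ← Finset.mul_sum, ← map_sum, hQ q κ, map_zero,
            mul_zero]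

/-- **«⟨∂A′, ∂H_kB⟩ = 0»** with the curvature map `∂A := (F_{μν}[A])_{μ,ν}` (`B5Action121.CurlOp`,
ordered pairs; `(CurlOp)ᴴ·CurlOp = 2·∂*∂`): `⟨CurlOp A′, CurlOp H_kB⟩ = 0` for every `A′ ∈ N(Q_k)` — in
particular on the printed subspace `{A′ : Q_kA′ = 0, R∂*A′ = 0}`.
[cite: Balaban1984PropagatorsI, p.29 «⟨∂A′, ∂H_kB⟩ = 0 on the subspace {A′ : Q_kA′ = 0, R∂*A′ = 0}» (text);
(1.21) p.21] -/
theorem curl_HkOp_orthogonal (B : Tor M × Fin d → ℂ) (A' : Tor (fine n M) × Fin d → ℂ)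
    (hA : QvOp n M *ᵥ A' = 0) :
    star (CurlOp (fine n M) (n : ℂ) *ᵥ A') ⬝ᵥ (CurlOp (fine n M) (n : ℂ) *ᵥ (HkOp n M *ᵥ B)) = 0 := by
  rw [star_mulVec_dotProduct, Matrix.mulVec_mulVec, curl_adjoint_curl, ← Lap_eq_LapV, Matrix.smul_mulVec,
    dotProduct_smul, smul_eq_mul, mul_eq_zero]
  exact Or.inr (form_DstarD_HkOp_eq_zero n M B A' hA)

/-- **THE THIRD PROPERTY OF p.29: «H_kB is a minimum of ½⟨∂A, ∂A⟩ on the hyperplane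
{A : Q_kA = B, R∂*A = 0}»** — `H_kB` lies on that hyperplane (`B5Hk163Torus.QvOp_HkOp_mulVec`,
`R_divS_HkOp`) and minimises `⟨A,(Δ − ∂∂*)A⟩ = ½Σ|F_{μν}|²` over the whole affine space `{A : Q_kA = B}`
(a fortiori over the hyperplane): `⟨A,(Δ−∂∂*)A⟩ = ⟨A′,(Δ−∂∂*)A′⟩ + ⟨H_kB,(Δ−∂∂*)H_kB⟩`, `A′ = A − H_kB ∈
N(Q_k)` (`form_DstarD_HkOp_eq_zero`), and the first term is `½Σ|F′|² ≥ 0`.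
[cite: Balaban1984PropagatorsI, p.29 (text); (1.47) p.26; (1.21) p.21] -/
theorem form_DstarD_decomp (B : Tor M × Fin d → ℂ) (A : Tor (fine n M) × Fin d → ℂ)
    (hA : QvOp n M *ᵥ A = B) :
    star A ⬝ᵥ (DstarD n M *ᵥ A)
      = star (A - HkOp n M *ᵥ B) ⬝ᵥ (DstarD n M *ᵥ (A - HkOp n M *ᵥ B))
        + star (HkOp n M *ᵥ B) ⬝ᵥ (DstarD n M *ᵥ (HkOp n M *ᵥ B)) := by
  set H := HkOp n M *ᵥ B with hH
  have hA' : QvOp n M *ᵥ (A - H) = 0 := by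
    rw [Matrix.mulVec_sub, hA, hH, QvOp_HkOp_mulVec, sub_self]
  have h1 : star (A - H) ⬝ᵥ (DstarD n M *ᵥ H) = 0 := form_DstarD_HkOp_eq_zero n M B (A - H) hA'
  have h2 : star H ⬝ᵥ (DstarD n M *ᵥ (A - H)) = 0 := by
    rw [star_dotProduct, star_mulVec_dotProduct, DstarD_conjTranspose, h1, star_zero]
  have e : A = (A - H) + H := (sub_add_cancel A H).symm
  conv_lhs => rw [e]
  rw [star_add, Matrix.mulVec_add, add_dotProduct, dotProduct_add, dotProduct_add, h1, h2, add_zero,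
    zero_add]

/-- **THE THIRD PROPERTY, as an inequality**: `⟨H_kB,(Δ−∂∂*)H_kB⟩ ≤ ⟨A,(Δ−∂∂*)A⟩` for every `A` with
`Q_kA = B`. [cite: Balaban1984PropagatorsI, p.29 «H_kB is a minimum of ½⟨∂A, ∂A⟩ on the hyperplane
{A : Q_kA = B, R∂*A = 0}» (text)] -/
theorem HkOp_minimum (B : Tor M × Fin d → ℂ) (A : Tor (fine n M) × Fin d → ℂ)
    (hA : QvOp n M *ᵥ A = B) :
    (star (HkOp n M *ᵥ B) ⬝ᵥ (DstarD n M *ᵥ (HkOp n M *ᵥ B))).re ≤ (star A ⬝ᵥ (DstarD n M *ᵥ A)).re := by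
  have hnn : 0 ≤ (star (A - HkOp n M *ᵥ B) ⬝ᵥ (DstarD n M *ᵥ (A - HkOp n M *ᵥ B))).re :=
    form_curl_nonneg (fine n M) (n : ℂ) (A - HkOp n M *ᵥ B)
  rw [form_DstarD_decomp n M B A hA, Complex.add_re]
  linarith

/-- **THE THIRD PROPERTY, in curvature form** ((1.21)): `Σ_{x,μ,ν}|F_{μν}[H_kB](x)|² ≤ Σ_{x,μ,ν}|F_{μν}[A](x)|²`
for every fine field `A` with `Q_kA = B`, and `H_kB` itself satisfies `Q_kH_kB = B`, `R∂*H_kB = 0`.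
[cite: Balaban1984PropagatorsI, p.29 (text); (1.21) p.21] -/
theorem HkOp_minimum_curvature (B : Tor M × Fin d → ℂ) (A : Tor (fine n M) × Fin d → ℂ)
    (hA : QvOp n M *ᵥ A = B) :
    (QvOp n M *ᵥ (HkOp n M *ᵥ B) = B
        ∧ (1 - PcT n M (n : ℂ)) *ᵥ ((GradOp (fine n M) (n : ℂ))ᴴ *ᵥ (HkOp n M *ᵥ B)) = 0)
      ∧ ∑ x, ∑ μ, ∑ ν, ‖Fs (fine n M) (n : ℂ) (HkOp n M *ᵥ B) μ ν x‖ ^ 2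
          ≤ ∑ x, ∑ μ, ∑ ν, ‖Fs (fine n M) (n : ℂ) A μ ν x‖ ^ 2 := by
  refine ⟨⟨QvOp_HkOp_mulVec n M B, R_divS_HkOp n M B⟩, ?_⟩
  have h := HkOp_minimum n M B A hA
  rw [form_DstarD, form_DstarD, Complex.ofReal_re, Complex.ofReal_re] at h
  linarith

end Minimum

/-! ## §5 Uniqueness: `H_kB` is THE minimum of `½⟨∂A,∂A⟩` on the printed hyperplane -/

section Unique

open Matrix
open scoped ComplexOrder

variable (n : ℕ) [NeZero n] (M : Fin d → ℕ) [hM : ∀ μ, NeZero (M μ)]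

/-- on the printed subspace `{A′ : Q_kA′ = 0, R∂*A′ = 0}` the operator `Δ_a = Δ − ∂P∂* + aQ*Q` of
(1.69)/(1.73) (`B5DeltaA169.DeltaA`) ACTS AS `∂*∂ = Δ − ∂∂*`: `Δ_aA′ = ∂*∂A′` (`P∂*A′ = ∂*A′`,
`QA′ = 0`). [cite: Balaban1984PropagatorsI, (1.69) p.29, (1.73) p.30] -/
theorem DeltaA_mulVec_eq_DstarD_mulVec (a : ℝ) (A' : Tor (fine n M) × Fin d → ℂ)
    (hQ : QvOp n M *ᵥ A' = 0)
    (hR : (1 - PcT n M (n : ℂ)) *ᵥ ((GradOp (fine n M) (n : ℂ))ᴴ *ᵥ A') = 0) :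
    DeltaA n M a *ᵥ A' = DstarD n M *ᵥ A' := by
  have hP : PcT n M (n : ℂ) *ᵥ ((GradOp (fine n M) (n : ℂ))ᴴ *ᵥ A')
      = (GradOp (fine n M) (n : ℂ))ᴴ *ᵥ A' := by
    rw [Matrix.sub_mulVec, Matrix.one_mulVec, sub_eq_zero] at hR
    exact hR.symm
  rw [DeltaA_mulVec, hQ, Matrix.mulVec_zero, smul_zero, add_zero, hP, DstarD, Matrix.sub_mulVec,
    Matrix.mulVec_mulVec]

/-- **UNIQUENESS OF THE MINIMISER on the printed hyperplane `{A : Q_kA = B, R∂*A = 0}`**: a fine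
field `A` on the hyperplane whose curvature form `⟨A, ∂*∂A⟩ = ½Σ|F_{μν}[A]|²` does not exceed that of
`H_kB` IS `H_kB`.  Proof: `A′ = A − H_kB` lies on the printed subspace, `⟨A′, ∂*∂A′⟩ = 0` by
`form_DstarD_decomp`, hence `⟨A′, Δ_aA′⟩ = 0` (`DeltaA_mulVec_eq_DstarD_mulVec`, `a = 1`), and
«Δ_a is a positive operator» (p.30; `B5DeltaA169.DeltaA_posDef`) forces `A′ = 0` — the gauge
condition `R∂*A = 0` is exactly what removes the degeneracy `A ↦ A + ∂λ` of `⟨∂A, ∂A⟩`.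
[cite: Balaban1984PropagatorsI, p.29 «H_kB is a minimum of ½⟨∂A, ∂A⟩ on the hyperplane
{A : Q_kA = B, R∂*A = 0}» (text); p.30 «Δ_a is a positive operator» (proof ours)] -/
theorem HkOp_minimum_unique (B : Tor M × Fin d → ℂ) (A : Tor (fine n M) × Fin d → ℂ)
    (hA : QvOp n M *ᵥ A = B)
    (hR : (1 - PcT n M (n : ℂ)) *ᵥ ((GradOp (fine n M) (n : ℂ))ᴴ *ᵥ A) = 0)
    (hmin : (star A ⬝ᵥ (DstarD n M *ᵥ A)).re
      ≤ (star (HkOp n M *ᵥ B) ⬝ᵥ (DstarD n M *ᵥ (HkOp n M *ᵥ B))).re) :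
    A = HkOp n M *ᵥ B := by
  have hn : 1 ≤ n := Nat.one_le_iff_ne_zero.mpr (NeZero.ne n)
  have hA' : QvOp n M *ᵥ (A - HkOp n M *ᵥ B) = 0 := by
    rw [Matrix.mulVec_sub, hA, QvOp_HkOp_mulVec, sub_self]
  have hR' : (1 - PcT n M (n : ℂ)) *ᵥ ((GradOp (fine n M) (n : ℂ))ᴴ *ᵥ (A - HkOp n M *ᵥ B)) = 0 := by
    rw [Matrix.mulVec_sub, Matrix.mulVec_sub, hR, R_divS_HkOp, sub_zero]
  have hdec := form_DstarD_decomp n M B A hA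
  have hr := form_DstarD n M (A - HkOp n M *ᵥ B)
  have hr0 : 0 ≤ (1 / 2 : ℝ) * ∑ x, ∑ μ, ∑ ν, ‖Fs (fine n M) (n : ℂ) (A - HkOp n M *ᵥ B) μ ν x‖ ^ 2 := by
    positivity
  have h1 := congrArg Complex.re hdec
  rw [Complex.add_re, hr, Complex.ofReal_re] at h1
  have hz0 : star (A - HkOp n M *ᵥ B) ⬝ᵥ (DstarD n M *ᵥ (A - HkOp n M *ᵥ B)) = 0 := by
    rw [hr, Complex.ofReal_eq_zero]
    linarith
  have hz : star (A - HkOp n M *ᵥ B) ⬝ᵥ (DeltaA n M 1 *ᵥ (A - HkOp n M *ᵥ B)) = 0 := by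
    rw [DeltaA_mulVec_eq_DstarD_mulVec n M 1 (A - HkOp n M *ᵥ B) hA' hR', hz0]
  by_contra hne
  have hpos := (DeltaA_posDef n hn M 1 one_pos).dotProduct_mulVec_pos (sub_ne_zero.mpr hne)
  rw [hz] at hpos
  exact lt_irrefl _ hpos

/-- **«H_kB is a minimum of ½⟨∂A, ∂A⟩ on the hyperplane {A : Q_kA = B, R∂*A = 0}» AS A
CHARACTERISATION**: `A = H_kB` if and only if `A` lies on the hyperplane and minimises the curvature
form `⟨A, ∂*∂A⟩ = ½Σ|F_{μν}[A]|²` on it. [cite: Balaban1984PropagatorsI, p.29 (text); (1.47) p.26] -/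
theorem eq_HkOp_iff_minimum (B : Tor M × Fin d → ℂ) (A : Tor (fine n M) × Fin d → ℂ) :
    A = HkOp n M *ᵥ B ↔
      (QvOp n M *ᵥ A = B
        ∧ (1 - PcT n M (n : ℂ)) *ᵥ ((GradOp (fine n M) (n : ℂ))ᴴ *ᵥ A) = 0
        ∧ ∀ A₂ : Tor (fine n M) × Fin d → ℂ, QvOp n M *ᵥ A₂ = B →
            (1 - PcT n M (n : ℂ)) *ᵥ ((GradOp (fine n M) (n : ℂ))ᴴ *ᵥ A₂) = 0 →
              (star A ⬝ᵥ (DstarD n M *ᵥ A)).re ≤ (star A₂ ⬝ᵥ (DstarD n M *ᵥ A₂)).re) := by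
  constructor
  · rintro rfl
    exact ⟨QvOp_HkOp_mulVec n M B, R_divS_HkOp n M B, fun A₂ h₂ _ => HkOp_minimum n M B A₂ h₂⟩
  · rintro ⟨hA, hR, hmin⟩
    exact HkOp_minimum_unique n M B A hA hR
      (hmin (HkOp n M *ᵥ B) (QvOp_HkOp_mulVec n M B) (R_divS_HkOp n M B))

end Unique

end

end Literature.MathematicalPhysics.QuantumFieldTheory.Balaban1983to89.B5Hk163RDiv
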